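/-
Copyright (c) 2026 the pub-hodgecm-mathlib formalisation cell (harness21).  Prover seat hodgecm-mathlib-K2Liu-p25 (g0), Track B «K2-LIT» ∕ hLiu418
#184♮ = `stmt-HodgeConjecture-24832`, Road Φ ∕ socket #41, organ G5-a (Φ7-2), face (β0) ∕ (u-0c) I1 — the `hχc` letter of ★ p861931
`K2LiuSiegelMiddleTermInnerFamily.innerFamily_torus_law` at the character of record `χ = toHeckeCharacter L lam⁻¹`, `lam` conjugate symplectic.
THEOREMS ONLY.
-/
import Summits.HodgeConjecture.HodgeConjecture.Theorems.K2LiuConjugateSymplecticInv     -- ★ `IsConjugateSymplectic.inv` (+ ★ `IsConjugateSymplectic.isConjugateSelfDual`, `galConj`)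
import Literature.NumberTheory.Automorphic.IdeleClassCharacterHecke                     -- ★ `toHeckeCharacter`, `coe_toHeckeCharacter_apply`
import Literature.NumberTheory.Automorphic.UnitaryGroupAutomorphicRep                   -- ★ `conjAdele`, `conjAdele_apply`
import Literature.NumberTheory.Automorphic.ClassFieldCharacter                          -- ★ the `Aut(L/L⁺)`-action on ideles, `AdeleRing.coe_smul_units`
import HarnessLib

/-!
# Crux `HLiu418`, Road Φ, face (β0) ∕ (u-0c) I1: THE DOUBLING CHARACTER IS TRIVIAL ON NORMS — `χ(d̄) · χ(d) = 1` for `χ = toHeckeCharacter L ψ`, `ψ` conjugate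
# self-dual (in particular `ψ = lam⁻¹`, `lam` conjugate symplectic): the binder `hχc` of ★ `K2LiuSiegelMiddleTermInnerFamily.innerFamily_torus_law`

Cell `hodgecm-mathlib`, crux item hLiu418 = `stmt-HodgeConjecture-24832`; squad K2 ∕ K2Liu; prover K2Liu-p25 (g0).  THEOREMS ONLY (no `def`, no instance, no
notation, no `sorry`); lane `--supports stmt-HodgeConjecture-24832 --as helper`.

WHY.  ★ (u-0c) I1 `K2LiuSiegelMiddleTermInnerFamily.innerFamily_torus_law` (the flat torus law `hφT` of the untwisted inner family of the middle term) takes ONE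
non-definitional letter by value: `hχc : ∀ d : 𝔸_Lˣ, χ (Units.map (conjAdele L⁺ L c) d) * χ d = 1` — the doubling character is trivial on norms `d d̄`.  At the character of
record of #41 (`siegelEisensteinContinuation_ten`: `χ = toHeckeCharacter L lam⁻¹`, `hlam : IsConjugateSymplectic L lam`) this is Liu's Def. 4.1: conjugate symplectic ⇒
conjugate self-dual ⇔ `ψ[ȳ] = ψ[y]⁻¹` (★ `IsConjugateSymplectic.isConjugateSelfDual`, ★ `isConjugateSelfDual_iff_galConj_eq_inv`), and `Units.map (conjAdele L⁺ L c) d = c • d`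
(definitional).  Heads: **`toHeckeCharacter_conj_mul_self_eq_one`** (any conjugate self-dual `ψ`), **`toHeckeCharacter_inv_conj_mul_self_eq_one`** (`ψ = lam⁻¹`, `lam` conjugate
symplectic — the `hχc` binder at the record VERBATIM up to `χ := toHeckeCharacter L lam⁻¹`).
References: [Liu2021, Def. 4.1, Remark 4.2, Remark 4.4]; [MoeglinWaldspurger1995, II.1.7].
HONEST LABEL.  Count-neutral helper: `HC_CM` is proved only modulo the 7 printed citations (2 remaining named inputs: hLiu418 = `stmt-HodgeConjecture-24832`,
h413 = `stmt-HodgeConjecture-24833`) until rung 0 closes; closes no socket by itself.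
-/

set_option autoImplicit false
set_option linter.dupNamespace false -- the mandated namespace repeats `HodgeConjecture.HodgeConjecture`

noncomputable section

open NumberField IsDedekindDomain
open Literature.NumberTheory.Automorphic Literature.NumberTheory.Automorphic.UnitaryGroup Literature.NumberTheory.Automorphic.IdeleClassGroup
open Literature.NumberTheory.GaloisRepresentations
open Summit.HodgeConjecture.HodgeConjecture.Cruxes.HLiu418.K2LiuConjugateSymplecticInv (IsConjugateSymplectic.inv)

namespace Summit.HodgeConjecture.HodgeConjecture.Cruxes.HLiu418.K2LiuSiegelMiddleTermCharacterNormTrivial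

variable {L : Type} [Field L] [NumberField L] [IsCMField L]

/-- `Units.map (c ⊗ 1) d = c • d` on ideles (definitional: ★ `conjAdele_apply`, ★ `AdeleRing.coe_smul_units`). [folklore] -/
theorem unitsMap_conjAdele_eq_smul (d : (AdeleRing (𝓞 L) L)ˣ) :
    Units.map (conjAdele (↥(maximalRealSubfield L)) L (IsCMField.complexConj L) : AdeleRing (𝓞 L) L →* AdeleRing (𝓞 L) L) d =
      IsCMField.complexConj L • d :=
  Units.ext rfl

/-- **`χ(d̄) · χ(d) = 1` for `χ = toHeckeCharacter L ψ`, `ψ` CONJUGATE SELF-DUAL** (`ψ[ȳ] = ψ[y]⁻¹`, ★ `isConjugateSelfDual_iff_galConj_eq_inv`). [cite: Liu2021, Def. 4.1] -/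
theorem toHeckeCharacter_conj_mul_self_eq_one {ψ : IdeleClassGroup L →ₜ* Circle} (hψ : IsConjugateSelfDual L ψ) (d : (AdeleRing (𝓞 L) L)ˣ) :
    toHeckeCharacter L ψ (Units.map (conjAdele (↥(maximalRealSubfield L)) L (IsCMField.complexConj L) : AdeleRing (𝓞 L) L →* AdeleRing (𝓞 L) L) d) *
      toHeckeCharacter L ψ d = 1 := by
  refine Units.ext ?_
  rw [Units.val_mul, Units.val_one, coe_toHeckeCharacter_apply, coe_toHeckeCharacter_apply, unitsMap_conjAdele_eq_smul, ← galConj_mk,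
    (isConjugateSelfDual_iff_galConj_eq_inv ψ).1 hψ, ← Circle.coe_mul, inv_mul_cancel, Circle.coe_one]

/-- **THE `hχc` BINDER OF ★ `innerFamily_torus_law` AT THE CHARACTER OF RECORD**: for `lam` conjugate symplectic and `χ = toHeckeCharacter L lam⁻¹`,
`χ(d̄) · χ(d) = 1` for every idele `d` (`lam⁻¹` is conjugate symplectic ★ `IsConjugateSymplectic.inv`, hence conjugate self-dual ★ `IsConjugateSymplectic.isConjugateSelfDual`).
[cite: Liu2021, Def. 4.1, Remark 4.4] -/
theorem toHeckeCharacter_inv_conj_mul_self_eq_one {lam : IdeleClassGroup L →ₜ* Circle} (hlam : IsConjugateSymplectic L lam) (d : (AdeleRing (𝓞 L) L)ˣ) :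
    toHeckeCharacter L lam⁻¹ (Units.map (conjAdele (↥(maximalRealSubfield L)) L (IsCMField.complexConj L) : AdeleRing (𝓞 L) L →* AdeleRing (𝓞 L) L) d) *
      toHeckeCharacter L lam⁻¹ d = 1 :=
  toHeckeCharacter_conj_mul_self_eq_one (IsConjugateSymplectic.inv hlam).isConjugateSelfDual d

/-- the same for `χ = toHeckeCharacter L lam` itself. [cite: Liu2021, Def. 4.1] -/
theorem toHeckeCharacter_conj_mul_self_eq_one_of_isConjugateSymplectic {lam : IdeleClassGroup L →ₜ* Circle} (hlam : IsConjugateSymplectic L lam)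
    (d : (AdeleRing (𝓞 L) L)ˣ) :
    toHeckeCharacter L lam (Units.map (conjAdele (↥(maximalRealSubfield L)) L (IsCMField.complexConj L) : AdeleRing (𝓞 L) L →* AdeleRing (𝓞 L) L) d) *
      toHeckeCharacter L lam d = 1 :=
  toHeckeCharacter_conj_mul_self_eq_one hlam.isConjugateSelfDual d

end Summit.HodgeConjecture.HodgeConjecture.Cruxes.HLiu418.K2LiuSiegelMiddleTermCharacterNormTrivial

end
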